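import Summits.NavierStokesRegularity.NavierStokesRegularity.Theorems.CriticalSwirlRegularity.Negative.MomentumUniformContinuityFalse
import Literature.Analysis.FluidPDE.LeiRenZhangSwirlWeights
import Literature.Analysis.FluidPDE.PeriodicCylinderFrameInversion
import Literature.Analysis.FluidPDE.AxisymVorticityAlgebra

/-!
# Calculus of the collapsing dip `c r²/(λ² + r²) + r²` (tools for `DirichletMomentumCollapse`)

Negative-side support for the crux `CriticalSwirlRegularity` (stmt-NavierStokesRegularity-1253, route
`FlatSwirlGauge`), line `registered` (birth skeleton `Cruxes/CriticalSwirlRegularity/Lines/birth.lean`), by the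
line lead (continuation c3, 2026-08-17). Theorems only (no definitions). This file is the calculus half of the
refutation of the DIRICHLET REPAIR of the skeleton's load-bearing stub `stub_momentumUniformContinuity` (see the
companion file `DirichletMomentumCollapse.lean` for the statement, the witness and the discussion):

* the one-variable profile `G(σ) = c σ/(λ² + σ) + σ` of the variable `σ = r²` and its first two derivatives
  `G'(σ) = c λ²/(λ² + σ)² + 1`, `G''(σ) = −2cλ²/(λ² + σ)³`;
* the planar-radial slice `a(x) = G(x₀² + x₁²)` on `ℝ³`: smooth, directional derivatives
  `∂ₕa(x) = 2G'(r²)(x₀h₀ + x₁h₁)`, and Laplacian `Δa(x) = 4cλ²(λ² − r²)/(λ² + r²)³ + 4` (planar radial formula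
  `Δ(G(|y|²)) = 4G''|y|² + 4G'` transported by the horizontal projection, in-tree `laplacian_comp_horizProj`,
  `laplacian_comp_norm_sq`);
* the time derivative of the momentum `α(t,x) = G_{λ(t)}(r²)`, `λ(t) = ν(T − t)`:
  `∂ₜα = 2cν λ r²/(λ² + r²)²`, and its joint smoothness (`Cⁿ`, every `n`) below the final time;
* the elementary real arithmetic of the drift numerator `E = ∂ₜα/ν − Δα`:
  `|E| ≤ 5 (cλ²/(λ²+r²)² + 1)` for `0 ≤ c ≤ 1`, against the directional slope `2(cλ²/(λ²+r²)² + 1)` of `a` along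
  the horizontal vector `(x₀, x₁, 0)`;
* two facts about the cylindrical radius used by the Dirichlet clauses: `r` is `1`-Lipschitz and
  `r(x) = dist(x, axis)` (`Metric.infDist` to the zero set of `r`).
-/

noncomputable section

namespace Summit.NavierStokesRegularity.NavierStokesRegularity.Theorems.CriticalSwirlRegularity.Negative

open MeasureTheory Filter Set Metric Real InnerProductSpace WithLp
open scoped RealInnerProductSpace Laplacian
open Literature.Analysis.FluidPDE

/-! ### The one-variable profile `G(σ) = c σ/(λ² + σ) + σ` -/

/-- `G'(σ) = cλ²/(λ²+σ)² + 1` for `λ² + σ > 0`. [folklore] -/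
theorem hasDerivAt_dipProfile {c lam σ : ℝ} (h : 0 < lam ^ 2 + σ) :
    HasDerivAt (fun σ : ℝ => c * (σ / (lam ^ 2 + σ)) + σ) (c * lam ^ 2 / (lam ^ 2 + σ) ^ 2 + 1) σ := by
  have hd : HasDerivAt (fun σ : ℝ => lam ^ 2 + σ) 1 σ := (hasDerivAt_id σ).const_add _
  have hq := ((hasDerivAt_id σ).div hd h.ne').const_mul c
  have hall := hq.add (hasDerivAt_id σ)
  refine hall.congr_deriv ?_
  simp only [id, one_mul, mul_one]
  field_simp
  ring

/-- `G''(σ) = −2cλ²/(λ²+σ)³` for `λ² + σ > 0`. [folklore] -/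
theorem hasDerivAt_dipProfile_deriv {c lam σ : ℝ} (h : 0 < lam ^ 2 + σ) :
    HasDerivAt (fun σ : ℝ => c * lam ^ 2 / (lam ^ 2 + σ) ^ 2 + 1)
      (-(2 * c * lam ^ 2) / (lam ^ 2 + σ) ^ 3) σ := by
  have hd : HasDerivAt (fun σ : ℝ => (lam ^ 2 + σ) ^ 2) (2 * (lam ^ 2 + σ)) σ := by
    have := ((hasDerivAt_id σ).const_add (lam ^ 2)).fun_pow 2
    refine this.congr_deriv ?_
    simp
  have hq := ((hasDerivAt_const σ (c * lam ^ 2)).div hd (by positivity)).add_const 1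
  refine hq.congr_deriv ?_
  have hne : lam ^ 2 + σ ≠ 0 := h.ne'
  field_simp
  ring

/-! ### The planar-radial slice `a(x) = c (x₀²+x₁²)/(λ² + x₀²+x₁²) + (x₀²+x₁²)` on `ℝ³` -/

/-- The slice is smooth when `λ ≠ 0` (a rational function with positive denominator). [folklore] -/
theorem contDiff_dipSlice (c : ℝ) {lam : ℝ} (hlam : lam ≠ 0) {n : WithTop ℕ∞} :
    ContDiff ℝ n fun y : EuclideanSpace ℝ (Fin 3) =>
      c * ((y 0 ^ 2 + y 1 ^ 2) / (lam ^ 2 + (y 0 ^ 2 + y 1 ^ 2))) + (y 0 ^ 2 + y 1 ^ 2) := by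
  have hpos : ∀ y : EuclideanSpace ℝ (Fin 3), 0 < lam ^ 2 + (y 0 ^ 2 + y 1 ^ 2) := fun y => by
    have : 0 < lam ^ 2 := by positivity
    positivity
  exact (contDiff_const.mul (contDiff_sq_add_sq.div (contDiff_const.add contDiff_sq_add_sq)
    fun y => (hpos y).ne')).add contDiff_sq_add_sq

/-- **Directional derivatives of the slice**: `∂ₕa(x) = 2 (cλ²/(λ²+r²)² + 1) (x₀h₀ + x₁h₁)`. [folklore] -/
theorem fderiv_dipSlice_apply (c : ℝ) {lam : ℝ} (hlam : lam ≠ 0) (x h : EuclideanSpace ℝ (Fin 3)) :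
    fderiv ℝ (fun y : EuclideanSpace ℝ (Fin 3) =>
        c * ((y 0 ^ 2 + y 1 ^ 2) / (lam ^ 2 + (y 0 ^ 2 + y 1 ^ 2))) + (y 0 ^ 2 + y 1 ^ 2)) x h =
      2 * (c * lam ^ 2 / (lam ^ 2 + (x 0 ^ 2 + x 1 ^ 2)) ^ 2 + 1) * (x 0 * h 0 + x 1 * h 1) := by
  have hpos : 0 < lam ^ 2 + (x 0 ^ 2 + x 1 ^ 2) := by
    have : 0 < lam ^ 2 := by positivity
    positivity
  have hcomp : (fun y : EuclideanSpace ℝ (Fin 3) =>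
      c * ((y 0 ^ 2 + y 1 ^ 2) / (lam ^ 2 + (y 0 ^ 2 + y 1 ^ 2))) + (y 0 ^ 2 + y 1 ^ 2)) =
      (fun σ : ℝ => c * (σ / (lam ^ 2 + σ)) + σ) ∘ fun y : EuclideanSpace ℝ (Fin 3) => y 0 ^ 2 + y 1 ^ 2 := rfl
  rw [hcomp, ((hasDerivAt_dipProfile hpos).comp_hasFDerivAt x (hasFDerivAt_horizSq x)).fderiv]
  simp
  ring

/-- **Laplacian of the slice**: `Δa(x) = 4cλ²(λ² − r²)/(λ² + r²)³ + 4` (planar radial formula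
`Δ(G(|y|²)) = 4G''|y|² + 4G'` transported by the horizontal projection). [folklore] -/
theorem laplacian_dipSlice (c : ℝ) {lam : ℝ} (hlam : lam ≠ 0) (x : EuclideanSpace ℝ (Fin 3)) :
    (Δ (fun y : EuclideanSpace ℝ (Fin 3) =>
        c * ((y 0 ^ 2 + y 1 ^ 2) / (lam ^ 2 + (y 0 ^ 2 + y 1 ^ 2))) + (y 0 ^ 2 + y 1 ^ 2))) x =
      4 * c * lam ^ 2 * (lam ^ 2 - (x 0 ^ 2 + x 1 ^ 2)) / (lam ^ 2 + (x 0 ^ 2 + x 1 ^ 2)) ^ 3 + 4 := by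
  obtain ⟨P, hP⟩ := exists_horizProj
  have hlam2 : 0 < lam ^ 2 := by positivity
  set G : ℝ → ℝ := fun σ => c * (σ / (lam ^ 2 + σ)) + σ with hG
  set G₁ : ℝ → ℝ := fun σ => c * lam ^ 2 / (lam ^ 2 + σ) ^ 2 + 1 with hG₁
  have hfun : (fun y : EuclideanSpace ℝ (Fin 3) =>
      c * ((y 0 ^ 2 + y 1 ^ 2) / (lam ^ 2 + (y 0 ^ 2 + y 1 ^ 2))) + (y 0 ^ 2 + y 1 ^ 2)) =
      fun y => (fun z : EuclideanSpace ℝ (Fin 2) => G (‖z‖ ^ 2)) (P y) := by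
    funext y
    simp only [hG, norm_sq_horizProj hP]
  set U : Set ℝ := Ioi (-lam ^ 2) with hU
  have hUo : IsOpen U := isOpen_Ioi
  have hUpos : ∀ s ∈ U, 0 < lam ^ 2 + s := fun s hs => by
    have : -lam ^ 2 < s := hs
    linarith
  have hgd : ∀ s ∈ U, HasDerivAt G (G₁ s) s := fun s hs => hasDerivAt_dipProfile (hUpos s hs)
  have hg2 : ContDiff ℝ 2 fun z : EuclideanSpace ℝ (Fin 2) => G (‖z‖ ^ 2) := by
    have h1 : ContDiff ℝ 2 fun z : EuclideanSpace ℝ (Fin 2) => lam ^ 2 + ‖z‖ ^ 2 :=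
      contDiff_const.add (contDiff_norm_sq ℝ)
    exact (contDiff_const.mul ((contDiff_norm_sq ℝ).div h1 fun z => by positivity)).add
      (contDiff_norm_sq ℝ)
  rw [hfun, laplacian_comp_horizProj hP hg2]
  have hz : ‖P x‖ ^ 2 ∈ U := by
    show -lam ^ 2 < ‖P x‖ ^ 2
    have := sq_nonneg ‖P x‖
    linarith
  have hg₁d : HasDerivAt G₁ (-(2 * c * lam ^ 2) / (lam ^ 2 + ‖P x‖ ^ 2) ^ 3) (‖P x‖ ^ 2) :=
    hasDerivAt_dipProfile_deriv (hUpos _ hz)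
  rw [laplacian_comp_norm_sq hUo hgd hz hg₁d, finrank_euclideanSpace, Fintype.card_fin, norm_sq_horizProj hP]
  simp only [hG₁]
  have hne : lam ^ 2 + (x 0 ^ 2 + x 1 ^ 2) ≠ 0 := by positivity
  push_cast
  field_simp
  ring

/-! ### Time derivative and joint regularity of the momentum `α(t,x) = G_{ν(T−t)}(r²)` -/

/-- `∂ₜ (c q/((ν(T−t))² + q) + q) = 2cν (ν(T−t)) q/((ν(T−t))² + q)²` (`q = r²` fixed) while the
denominator is positive. [folklore] -/
theorem hasDerivAt_dipMomentum_time {c ν T t q : ℝ} (h : 0 < (ν * (T - t)) ^ 2 + q) :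
    HasDerivAt (fun s : ℝ => c * (q / ((ν * (T - s)) ^ 2 + q)) + q)
      (2 * c * ν * (ν * (T - t)) * q / ((ν * (T - t)) ^ 2 + q) ^ 2) t := by
  have h1 : HasDerivAt (fun s : ℝ => (ν * (T - s)) ^ 2 + q) (2 * (ν * (T - t)) * (ν * -1)) t := by
    have hlin : HasDerivAt (fun s : ℝ => ν * (T - s)) (ν * -1) t :=
      ((hasDerivAt_id t).const_sub T).const_mul ν |>.congr_deriv (by simp)
    simpa using (hlin.pow 2).add_const q
  have h2 := (((hasDerivAt_const t q).div h1 h.ne').const_mul c).add_const q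
  refine h2.congr_deriv ?_
  have hne : (ν * (T - t)) ^ 2 + q ≠ 0 := h.ne'
  field_simp
  ring

/-- **The momentum is smooth below the final time**: `(t,x) ↦ c r²/((ν(T−t))² + r²) + r²` is `Cⁿ` (every
`n`) on `(T−ρ², T) × B_ρ(0)` (`ν > 0`). [folklore] -/
theorem contDiffOn_dipMomentum (c : ℝ) {ν T ρ : ℝ} (hν : 0 < ν) {n : WithTop ℕ∞} :
    ContDiffOn ℝ n
      (Function.uncurry fun (t : ℝ) (y : EuclideanSpace ℝ (Fin 3)) =>
        c * ((y 0 ^ 2 + y 1 ^ 2) / ((ν * (T - t)) ^ 2 + (y 0 ^ 2 + y 1 ^ 2))) + (y 0 ^ 2 + y 1 ^ 2))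
      (Set.Ioo (T - ρ ^ 2) T ×ˢ Metric.ball (0 : EuclideanSpace ℝ (Fin 3)) ρ) := by
  have hpos : ∀ p ∈ Set.Ioo (T - ρ ^ 2) T ×ˢ Metric.ball (0 : EuclideanSpace ℝ (Fin 3)) ρ,
      0 < (ν * (T - p.1)) ^ 2 + (p.2 0 ^ 2 + p.2 1 ^ 2) := fun p hp => by
    rw [Set.mem_prod, Set.mem_Ioo] at hp
    have : 0 < ν * (T - p.1) := mul_pos hν (by linarith [hp.1.2])
    positivity
  have hq : ContDiff ℝ n (fun p : ℝ × EuclideanSpace ℝ (Fin 3) => p.2 0 ^ 2 + p.2 1 ^ 2) :=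
    contDiff_sq_add_sq.comp contDiff_snd
  have hden : ContDiff ℝ n (fun p : ℝ × EuclideanSpace ℝ (Fin 3) =>
      (ν * (T - p.1)) ^ 2 + (p.2 0 ^ 2 + p.2 1 ^ 2)) :=
    ((contDiff_const.mul (contDiff_const.sub contDiff_fst)).pow 2).add hq
  exact (contDiffOn_const.mul (hq.contDiffOn.div hden.contDiffOn fun p hp => (hpos p hp).ne')).add
    hq.contDiffOn

/-! ### Elementary real arithmetic of the drift -/

/-- **Bound on the drift numerator.** With `den = λ² + q`, `λ > 0`, `q ≥ 0`, `0 ≤ c ≤ 1`: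
`|2cλq/den² − (4cλ²(λ² − q)/den³ + 4)| ≤ 5 (cλ²/den² + 1)`
(`2λq ≤ λ² + q²`, `q² ≤ den²`, `|λ² − q| ≤ den`). [folklore] -/
theorem dip_numerator_abs_le {c lam q : ℝ} (hlam : 0 < lam) (hq : 0 ≤ q) (hc0 : 0 ≤ c) (hc1 : c ≤ 1) :
    |2 * c * lam * q / (lam ^ 2 + q) ^ 2 - (4 * c * lam ^ 2 * (lam ^ 2 - q) / (lam ^ 2 + q) ^ 3 + 4)| ≤
      5 * (c * lam ^ 2 / (lam ^ 2 + q) ^ 2 + 1) := by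
  have hden : 0 < lam ^ 2 + q := by positivity
  set den := lam ^ 2 + q with hden_def
  have hK0 : 0 ≤ c * lam ^ 2 / den ^ 2 := by positivity
  -- first term: `0 ≤ 2cλq/den² ≤ cλ²/den² + c`
  have hA0 : 0 ≤ 2 * c * lam * q / den ^ 2 := by positivity
  have hA : 2 * c * lam * q / den ^ 2 ≤ c * lam ^ 2 / den ^ 2 + c := by
    have h1 : 2 * c * lam * q / den ^ 2 ≤ (c * lam ^ 2 + c * den ^ 2) / den ^ 2 := by
      refine div_le_div_of_nonneg_right ?_ (by positivity)
      have hqd : q ^ 2 ≤ den ^ 2 := by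
        rw [hden_def]; nlinarith [sq_nonneg lam]
      nlinarith [sq_nonneg (lam - q), mul_nonneg hc0 (sq_nonneg (lam - q)), mul_nonneg hc0 (sub_nonneg.2 hqd)]
    have h2 : (c * lam ^ 2 + c * den ^ 2) / den ^ 2 = c * lam ^ 2 / den ^ 2 + c := by
      field_simp
    linarith
  -- second term: `|4cλ²(λ² − q)/den³| ≤ 4cλ²/den²`
  have hB : |4 * c * lam ^ 2 * (lam ^ 2 - q) / den ^ 3| ≤ 4 * (c * lam ^ 2 / den ^ 2) := by
    rw [abs_div, abs_of_pos (pow_pos hden 3), div_le_iff₀ (pow_pos hden 3), abs_mul,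
      abs_of_nonneg (by positivity : (0 : ℝ) ≤ 4 * c * lam ^ 2)]
    have habs : |lam ^ 2 - q| ≤ den := by
      rw [hden_def]; exact abs_le.2 ⟨by nlinarith [sq_nonneg lam], by nlinarith [sq_nonneg lam]⟩
    calc 4 * c * lam ^ 2 * |lam ^ 2 - q| ≤ 4 * c * lam ^ 2 * den :=
          mul_le_mul_of_nonneg_left habs (by positivity)
      _ = 4 * (c * lam ^ 2 / den ^ 2) * den ^ 3 := by
          field_simp
  -- combine
  have htri1 : |2 * c * lam * q / den ^ 2 - (4 * c * lam ^ 2 * (lam ^ 2 - q) / den ^ 3 + 4)| ≤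
      |2 * c * lam * q / den ^ 2| + |4 * c * lam ^ 2 * (lam ^ 2 - q) / den ^ 3 + 4| := abs_sub _ _
  have htri2 : |4 * c * lam ^ 2 * (lam ^ 2 - q) / den ^ 3 + 4| ≤
      |4 * c * lam ^ 2 * (lam ^ 2 - q) / den ^ 3| + |(4 : ℝ)| := abs_add_le _ _
  rw [abs_of_nonneg hA0] at htri1
  have h4 : |(4 : ℝ)| = 4 := abs_of_pos (by norm_num)
  rw [h4] at htri2
  nlinarith

/-! ### Two facts about the cylindrical radius (for the Dirichlet clauses) -/

/-- **The cylindrical radius is `1`-Lipschitz**: `|r(x) − r(y)| ≤ dist x y`. [folklore] -/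
theorem abs_cylRadius_sub_cylRadius_le (x y : EuclideanSpace ℝ (Fin 3)) :
    |cylRadius x - cylRadius y| ≤ dist x y := by
  obtain ⟨hx, -, -⟩ := horizontal_vector_facts x
  obtain ⟨hy, -, -⟩ := horizontal_vector_facts y
  obtain ⟨hxy, -, -⟩ := horizontal_vector_facts (x - y)
  rw [← hx, ← hy, dist_eq_norm]
  refine (abs_norm_sub_norm_le _ _).trans ?_
  have hlin : EuclideanSpace.single (0 : Fin 3) (x 0) + EuclideanSpace.single (1 : Fin 3) (x 1) -
      (EuclideanSpace.single (0 : Fin 3) (y 0) + EuclideanSpace.single (1 : Fin 3) (y 1)) =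
      EuclideanSpace.single (0 : Fin 3) ((x - y) 0) + EuclideanSpace.single (1 : Fin 3) ((x - y) 1) := by
    ext i
    fin_cases i <;> simp
  rw [hlin, hxy]
  exact cylRadius_le_norm _

/-- **The cylindrical radius is the distance to the axis**: `r(x) = dist(x, {r = 0})`. [folklore] -/
theorem cylRadius_eq_infDist (x : EuclideanSpace ℝ (Fin 3)) :
    cylRadius x = Metric.infDist x {y : EuclideanSpace ℝ (Fin 3) | cylRadius y = 0} := by
  -- the foot of the perpendicular: `z = (0, 0, x₂)`
  set z : EuclideanSpace ℝ (Fin 3) := EuclideanSpace.single (2 : Fin 3) (x 2) with hz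
  have hz0 : cylRadius z = 0 := by
    rw [cylRadius_eq_zero_iff]
    simp [hz]
  have hne : ({y : EuclideanSpace ℝ (Fin 3) | cylRadius y = 0}).Nonempty := ⟨z, hz0⟩
  refine le_antisymm ((Metric.le_infDist hne).2 fun y hy => ?_) ?_
  · -- `r(x) = r(x) - r(y) ≤ dist x y` on the axis
    have h := abs_cylRadius_sub_cylRadius_le x y
    rw [Set.mem_setOf_eq] at hy
    rw [hy, sub_zero, abs_of_nonneg (cylRadius_nonneg x)] at h
    exact h
  · -- `dist(x, axis) ≤ dist x z = r(x)`
    have hzmem : z ∈ {y : EuclideanSpace ℝ (Fin 3) | cylRadius y = 0} := hz0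
    refine (Metric.infDist_le_dist_of_mem hzmem).trans (le_of_eq ?_)
    obtain ⟨hx, -, -⟩ := horizontal_vector_facts x
    rw [dist_eq_norm, ← hx]
    congr 1
    ext i
    fin_cases i <;> simp [hz]

end Summit.NavierStokesRegularity.NavierStokesRegularity.Theorems.CriticalSwirlRegularity.Negative
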